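import Literature.Algebra.Homology.CartanCriterion
import HarnessLib

/-!
# Čech cohomology and the coefficient universe: injective sheaves stay acyclic after `ulift`

For an abelian presheaf `P : Cᵒᵖ ⥤ Ab.{max w v}` and a family of arrows `𝔙 = (V_k → U)_{k : ι}`,
`ι : Type w`, the Čech complex `Č•(𝔙, P) = Hom(ℤ[N(𝔙)]_•, P)` (`CechNerve.lean`) and the Čech
complex `Č•(𝔙', P ⋙ uliftFunctor)` of the *same* family with indices lifted to `Type (max w w₂)`
(`preZeroHypercoverULift`) and coefficients lifted to `Ab.{max w v w₂}` have the same
cochains up to `ULift` (`cechCochainUp`/`cechCochainDown`, values on simplices transported along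
`cechSimplexDown`/`cechSimplexUp`) compatibly with the differentials (`cechCochainUp_d`,
`cechCochainDown_d`), so exactness in positive degrees passes from the former to the latter
(`cechCochainComplex_uliftFunctor_exactAt_succ`). Consequently:

* `subsingleton_ext_freeSheaf_sheafCompose_uliftFunctor_of_injective` — **an injective abelian
  sheaf `I` stays acyclic after enlarging the coefficient universe**: `Extᵖ(ℤ[h_X], ulift I) = 0`
  for all `p > 0` and all objects `X`, where `ulift I = (sheafCompose J uliftFunctor).obj I`
  (though `ulift I` need not be known to be injective): `I` is Čech-acyclic (Milne III 2.4,
  `cechCochainComplex_exactAt_succ_of_injective`), hence so is `ulift I`, and Cartan's criterion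
  (`subsingleton_ext_freeSheaf_of_cech_exactAt_of_cofinal`) applies, provided every covering
  sieve contains a covering family indexed in `Type w`;
* `subsingleton_sheafH_sheafCompose_uliftFunctor_of_injective` — the same for Mathlib's
  `Sheaf.H` at a terminal object: `Hᵖ(ulift I) = 0`, `p > 0`.

This is the independence of sheaf cohomology from the coefficient universe on injectives — input
(B) "`Hᵖ(X_ét, ulift I) = 0`" of the globalization of Bhatt–Scholze Cor. 5.1.6 in
`Literature/AlgebraicGeometry/Motives/EtaleToProetLeray.lean`, forced there by the coefficient
convention `Ab.{u+1}` of `Scheme.EllAdicCohomology` on the pro-étale site.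

## References

* J. S. Milne, *Étale cohomology* (2025 reissue): III Lemma 2.4 (injectives are Čech-acyclic),
  III Prop. 2.12 (Čech-acyclic ⇒ acyclic). [Milne2025]
* The Stacks Project, Tag 03F9. [StacksProject]

## Design notes

* Universes: site `C : Type u`, `[Category.{v} C]`; small coefficients `Ab.{max w v}` with
  families indexed in `Type w`; the lift `AddCommGrpCat.uliftFunctor.{w₂} : Ab.{max w v} ⥤
  Ab.{max w v w₂}` with families reindexed in `Type (max w w₂)`. For the étale site of
  `X : Scheme.{u}` (`v = u`, `Shv(X_ét, Ab.{u})`, `w = u`) and `w₂ = u + 1` this is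
  `uliftEtSheaf X : Shv(X_ét, Ab.{u}) → Shv(X_ét, Ab.{u+1})` of `EtaleToProetExt.lean`.
* Exactness is transported through the elementwise characterisation
  (`HomologicalComplex.exactAt_iff'`, `ShortComplex.ab_exact_iff`), not through an isomorphism of
  complexes, so that no common universe for the two complexes is needed.
* Only theorems and real definitions; no named facts (D-0026).
* Mathlib searched: no lemma relating `sheafCompose _ uliftFunctor` to injectivity, `Ext` or
  `Sheaf.H`; `GrothendieckTopology.PreservesSheafification` instances for `uliftFunctor` need
  limits of the size of the site in the *small* coefficient category and do not apply to large
  sites such as `X.Etale`. Nothing restated.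
-/

universe w' w v u

open CategoryTheory Opposite Limits Abelian Simplicial

namespace Literature.Algebra.Homology

/-! ### Čech complexes and the change of coefficient universe `P ↦ P ⋙ uliftFunctor` -/

section CechULift

universe w₂

variable {C : Type u} [Category.{v} C] {U : C} (𝒱 : PreZeroHypercover.{w} U)

/-- Reindex a family along `ULift`: the same family, with index type lifted to a higher universe
(so that its Čech complexes with coefficients in a higher universe are defined). [folklore] -/
def preZeroHypercoverULift : PreZeroHypercover.{max w w₂} U where
  I₀ := ULift.{w₂} 𝒱.I₀
  X i := 𝒱.X i.down
  f i := 𝒱.f i.down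

/-- Simplices of the reindexed family are simplices of the family (lower the indices). [folklore] -/
def cechSimplexDown {n : ℕ} {T : Cᵒᵖ} (x : (cechSimplex (preZeroHypercoverULift.{w, v, u, w₂} 𝒱).f n).obj T) :
    (cechSimplex 𝒱.f n).obj T :=
  ⟨fun a => ⟨(x.1 a).1.down, (x.1 a).2⟩, fun a b => x.2 a b⟩

/-- Simplices of the family are simplices of the reindexed family (lift the indices). [folklore] -/
def cechSimplexUp {n : ℕ} {T : Cᵒᵖ} (x : (cechSimplex 𝒱.f n).obj T) :
    (cechSimplex (preZeroHypercoverULift.{w, v, u, w₂} 𝒱).f n).obj T :=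
  ⟨fun a => ⟨ULift.up (x.1 a).1, (x.1 a).2⟩, fun a b => x.2 a b⟩

/-- `down ∘ up = id` on simplices. [folklore] -/
@[simp] lemma cechSimplexDown_up {n : ℕ} {T : Cᵒᵖ} (x : (cechSimplex 𝒱.f n).obj T) :
    cechSimplexDown 𝒱 (cechSimplexUp.{w, v, u, w₂} 𝒱 x) = x := rfl

/-- `up ∘ down = id` on simplices. [folklore] -/
@[simp] lemma cechSimplexUp_down {n : ℕ} {T : Cᵒᵖ}
    (x : (cechSimplex (preZeroHypercoverULift.{w, v, u, w₂} 𝒱).f n).obj T) :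
    cechSimplexUp 𝒱 (cechSimplexDown 𝒱 x) = x := rfl

/-- Lowering indices commutes with the presheaf structure. [folklore] -/
lemma cechSimplexDown_map {n : ℕ} {T T' : Cᵒᵖ} (g : T ⟶ T')
    (x : (cechSimplex (preZeroHypercoverULift.{w, v, u, w₂} 𝒱).f n).obj T) :
    cechSimplexDown 𝒱 ((cechSimplex (preZeroHypercoverULift.{w, v, u, w₂} 𝒱).f n).map g x) =
      (cechSimplex 𝒱.f n).map g (cechSimplexDown 𝒱 x) := rfl

/-- Lifting indices commutes with the presheaf structure. [folklore] -/
lemma cechSimplexUp_map {n : ℕ} {T T' : Cᵒᵖ} (g : T ⟶ T') (x : (cechSimplex 𝒱.f n).obj T) :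
    cechSimplexUp.{w, v, u, w₂} 𝒱 ((cechSimplex 𝒱.f n).map g x) =
      (cechSimplex (preZeroHypercoverULift.{w, v, u, w₂} 𝒱).f n).map g (cechSimplexUp 𝒱 x) := rfl

/-- Lowering indices commutes with faces (by `rfl`: both sides restrict along the same map of
finite sets). [folklore] -/
lemma cechSimplexDown_cechFace (n : ℕ) (i : Fin (n + 2)) (T : Cᵒᵖ)
    (x : (cechSimplex (preZeroHypercoverULift.{w, v, u, w₂} 𝒱).f (n + 1)).obj T) :
    cechSimplexDown 𝒱 (cechFace (preZeroHypercoverULift.{w, v, u, w₂} 𝒱).f n i T x) =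
      cechFace 𝒱.f n i T (cechSimplexDown 𝒱 x) := rfl

/-- Lifting indices commutes with faces. [folklore] -/
lemma cechSimplexUp_cechFace (n : ℕ) (i : Fin (n + 2)) (T : Cᵒᵖ)
    (x : (cechSimplex 𝒱.f (n + 1)).obj T) :
    cechSimplexUp.{w, v, u, w₂} 𝒱 (cechFace 𝒱.f n i T x) =
      cechFace (preZeroHypercoverULift.{w, v, u, w₂} 𝒱).f n i T (cechSimplexUp 𝒱 x) := rfl

variable (P : Cᵒᵖ ⥤ AddCommGrpCat.{max w v})

/-- Naturality of `x ↦ up (φ (down x))`. [folklore] -/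
lemma cechCochainUp_aux {n : ℕ} (φ : (cechNerveComplex 𝒱.f).X n ⟶ P) {T T' : Cᵒᵖ} (g : T ⟶ T')
    (x : (cechSimplex (preZeroHypercoverULift.{w, v, u, w₂} 𝒱).f n).obj T) :
    (P ⋙ AddCommGrpCat.uliftFunctor.{w₂}).map g (ULift.up (cechEval 𝒱.f φ T (cechSimplexDown 𝒱 x))) =
      ULift.up (cechEval 𝒱.f φ T' (cechSimplexDown 𝒱
        ((cechSimplex (preZeroHypercoverULift.{w, v, u, w₂} 𝒱).f n).map g x))) := by
  change ULift.up (P.map g (cechEval 𝒱.f φ T (cechSimplexDown 𝒱 x))) = _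
  rw [map_cechEval]
  rfl

/-- Transport of Čech cochains to the reindexed family with lifted coefficients:
`φ ↦ (x ↦ up (φ (down x)))`. [folklore] -/
noncomputable def cechCochainUp {n : ℕ} (φ : (cechNerveComplex 𝒱.f).X n ⟶ P) :
    (cechNerveComplex (preZeroHypercoverULift.{w, v, u, w₂} 𝒱).f).X n ⟶ P ⋙ AddCommGrpCat.uliftFunctor.{w₂} :=
  cechLift _ (fun T x => ULift.up (cechEval 𝒱.f φ T (cechSimplexDown 𝒱 x)))
    (fun g x => cechCochainUp_aux 𝒱 P φ g x)

/-- Values of `cechCochainUp`. [folklore] -/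
@[simp] lemma cechEval_cechCochainUp {n : ℕ} (φ : (cechNerveComplex 𝒱.f).X n ⟶ P) (T : Cᵒᵖ)
    (x : (cechSimplex (preZeroHypercoverULift.{w, v, u, w₂} 𝒱).f n).obj T) :
    cechEval _ (cechCochainUp 𝒱 P φ) T x = ULift.up (cechEval 𝒱.f φ T (cechSimplexDown 𝒱 x)) :=
  cechEval_cechLift _ _ (fun g x => cechCochainUp_aux 𝒱 P φ g x) T x

/-- Naturality of `x ↦ down (φ' (up x))`. [folklore] -/
lemma cechCochainDown_aux {n : ℕ}
    (φ' : (cechNerveComplex (preZeroHypercoverULift.{w, v, u, w₂} 𝒱).f).X n ⟶ P ⋙ AddCommGrpCat.uliftFunctor.{w₂})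
    {T T' : Cᵒᵖ} (g : T ⟶ T') (x : (cechSimplex 𝒱.f n).obj T) :
    P.map g (cechEval _ φ' T (cechSimplexUp.{w, v, u, w₂} 𝒱 x)).down =
      (cechEval _ φ' T' (cechSimplexUp.{w, v, u, w₂} 𝒱 ((cechSimplex 𝒱.f n).map g x))).down := by
  rw [cechSimplexUp_map, ← map_cechEval]
  rfl

/-- Transport of Čech cochains back: `φ' ↦ (x ↦ down (φ' (up x)))`. [folklore] -/
noncomputable def cechCochainDown {n : ℕ}
    (φ' : (cechNerveComplex (preZeroHypercoverULift.{w, v, u, w₂} 𝒱).f).X n ⟶ P ⋙ AddCommGrpCat.uliftFunctor.{w₂}) :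
    (cechNerveComplex 𝒱.f).X n ⟶ P :=
  cechLift _ (fun T x => (cechEval _ φ' T (cechSimplexUp.{w, v, u, w₂} 𝒱 x)).down)
    (fun g x => cechCochainDown_aux 𝒱 P φ' g x)

/-- Values of `cechCochainDown`. [folklore] -/
@[simp] lemma cechEval_cechCochainDown {n : ℕ}
    (φ' : (cechNerveComplex (preZeroHypercoverULift.{w, v, u, w₂} 𝒱).f).X n ⟶ P ⋙ AddCommGrpCat.uliftFunctor.{w₂})
    (T : Cᵒᵖ) (x : (cechSimplex 𝒱.f n).obj T) :
    cechEval _ (cechCochainDown 𝒱 P φ') T x =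
      (cechEval _ φ' T (cechSimplexUp.{w, v, u, w₂} 𝒱 x)).down :=
  cechEval_cechLift _ _ (fun g x => cechCochainDown_aux 𝒱 P φ' g x) T x

/-- `up ∘ down = id` on cochains. [folklore] -/
lemma cechCochainUp_down {n : ℕ}
    (φ' : (cechNerveComplex (preZeroHypercoverULift.{w, v, u, w₂} 𝒱).f).X n ⟶ P ⋙ AddCommGrpCat.uliftFunctor.{w₂}) :
    cechCochainUp 𝒱 P (cechCochainDown 𝒱 P φ') = φ' := by
  apply cech_hom_ext
  intro T x
  rw [cechEval_cechCochainUp, cechEval_cechCochainDown, cechSimplexUp_down]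
  rfl

/-- The Čech differential commutes with `cechCochainUp`. [folklore] -/
lemma cechCochainUp_d {n : ℕ} (φ : (cechNerveComplex 𝒱.f).X n ⟶ P) :
    cechCochainUp 𝒱 P ((cechCochainComplex 𝒱.f P).d n (n + 1) φ) =
      (cechCochainComplex _ (P ⋙ AddCommGrpCat.uliftFunctor.{w₂})).d n (n + 1)
        (cechCochainUp 𝒱 P φ) := by
  apply cech_hom_ext
  intro T x
  rw [cechEval_cechCochainUp, cechEval_d, cechEval_d]
  have hup : ∀ (s : Finset (Fin (n + 2))) (g : Fin (n + 2) → P.obj T),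
      ULift.up (∑ i ∈ s, g i) = ∑ i ∈ s, ULift.up (g i) := fun s g =>
    map_sum (AddEquiv.ulift (α := P.obj T)).symm g s
  rw [hup]
  refine Finset.sum_congr rfl fun i _ => ?_
  rw [cechEval_cechCochainUp, cechSimplexDown_cechFace]
  rfl

/-- The Čech differential commutes with `cechCochainDown`. [folklore] -/
lemma cechCochainDown_d {n : ℕ}
    (φ' : (cechNerveComplex (preZeroHypercoverULift.{w, v, u, w₂} 𝒱).f).X n ⟶ P ⋙ AddCommGrpCat.uliftFunctor.{w₂}) :
    cechCochainDown 𝒱 P ((cechCochainComplex _ (P ⋙ AddCommGrpCat.uliftFunctor.{w₂})).d n (n + 1) φ') =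
      (cechCochainComplex 𝒱.f P).d n (n + 1) (cechCochainDown 𝒱 P φ') := by
  apply cech_hom_ext
  intro T x
  rw [cechEval_cechCochainDown, cechEval_d, cechEval_d]
  have hdown : ∀ (s : Finset (Fin (n + 2))) (g : Fin (n + 2) → ULift.{w₂} (P.obj T)),
      (∑ i ∈ s, g i).down = ∑ i ∈ s, (g i).down := fun s g =>
    map_sum (AddEquiv.ulift (α := P.obj T)) g s
  erw [hdown]
  refine Finset.sum_congr rfl fun i _ => ?_
  rw [cechEval_cechCochainDown, cechSimplexUp_cechFace]
  rfl

/-- **Čech exactness is insensitive to lifting the coefficient universe**: if `Č•(𝒱, P)` is exact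
in degree `n + 1`, so is `Č•(𝒱', P ⋙ uliftFunctor)` for the reindexed family `𝒱'`. [folklore] -/
theorem cechCochainComplex_uliftFunctor_exactAt_succ (n : ℕ)
    (h : (cechCochainComplex 𝒱.f P).ExactAt (n + 1)) :
    (cechCochainComplex (preZeroHypercoverULift.{w, v, u, w₂} 𝒱).f
      (P ⋙ AddCommGrpCat.uliftFunctor.{w₂})).ExactAt (n + 1) := by
  have h' := ((cechCochainComplex 𝒱.f P).exactAt_iff' n (n + 1) (n + 2) (by simp) (by simp)).1 h
  rw [ShortComplex.ab_exact_iff] at h'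
  rw [(cechCochainComplex _ (P ⋙ AddCommGrpCat.uliftFunctor.{w₂})).exactAt_iff' n (n + 1) (n + 2)
    (by simp) (by simp), ShortComplex.ab_exact_iff]
  intro φ' hφ'
  change (cechCochainComplex _ _).d (n + 1) (n + 2) φ' = 0 at hφ'
  obtain ⟨ψ, hψ⟩ := h' (cechCochainDown 𝒱 P φ') (by
    change (cechCochainComplex 𝒱.f P).d (n + 1) (n + 2) (cechCochainDown 𝒱 P φ') = 0
    rw [← cechCochainDown_d, hφ']
    apply cech_hom_ext
    intro T x
    rw [cechEval_cechCochainDown]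
    rfl)
  refine ⟨cechCochainUp 𝒱 P ψ, ?_⟩
  change (cechCochainComplex _ _).d n (n + 1) (cechCochainUp 𝒱 P ψ) = φ'
  change (cechCochainComplex 𝒱.f P).d n (n + 1) ψ = _ at hψ
  rw [← cechCochainUp_d, hψ, cechCochainUp_down]

end CechULift

/-! ### Injective sheaves stay acyclic after lifting the coefficient universe -/

section ULiftAcyclic

universe w₂

variable {C : Type u} [Category.{v} C] {J : GrothendieckTopology C}
  [HasSheafify J AddCommGrpCat.{max w v}]
  [J.HasSheafCompose AddCommGrpCat.uliftFunctor.{w₂, max w v}]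
  [HasSheafify J AddCommGrpCat.{max (max w v) w₂}]
  [J.HasSheafCompose (forget AddCommGrpCat.{max (max w v) w₂})]
  [J.WEqualsLocallyBijective AddCommGrpCat.{max (max w v) w₂}]
  [HasExt.{w'} (Sheaf J AddCommGrpCat.{max (max w v) w₂})]
  [EnoughInjectives (Sheaf J AddCommGrpCat.{max (max w v) w₂})] [HasFiniteWidePullbacks C]

/-- **An injective abelian sheaf stays acyclic after enlarging the coefficient universe.** Let
`I` be an injective object of `Shv(C, J; Ab.{max w v})` and `ulift I := I ⋙ uliftFunctor` the same
sheaf with coefficients in the larger universe `max w v w₂` (Mathlib `sheafCompose _ uliftFunctor`).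
If every covering sieve contains a covering family indexed in `Type w`, then
`Extᵖ(ℤ[h_X]^#, ulift I) = 0` for all `p > 0` and all `X` — although `ulift I` need not be known to
be injective. Proof: `I` is Čech-acyclic (Milne III 2.4, `cechCochainComplex_exactAt_succ_of_injective`),
Čech exactness is insensitive to the coefficient universe
(`cechCochainComplex_uliftFunctor_exactAt_succ`), and Cartan's criterion
(`subsingleton_ext_freeSheaf_of_cech_exactAt_of_cofinal`). This is the input that makes sheaf
cohomology independent of the coefficient universe. [folklore] -/
theorem subsingleton_ext_freeSheaf_sheafCompose_uliftFunctor_of_injective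
    (hcof : ∀ (X : C), ∀ S₀ ∈ J X, ∃ 𝒱 : PreZeroHypercover.{w} X,
      Sieve.generate (Presieve.ofArrows 𝒱.X 𝒱.f) ∈ J X ∧ ∀ k, S₀ (𝒱.f k))
    (I : Sheaf J AddCommGrpCat.{max w v}) [Injective I] (X : C) (n : ℕ) :
    Subsingleton (Ext.{w'} (freeSheaf.{max w w₂} J X)
      ((sheafCompose J AddCommGrpCat.uliftFunctor.{w₂, max w v}).obj I) (n + 1)) := by
  refine subsingleton_ext_freeSheaf_of_cech_exactAt_of_cofinal.{w', max w w₂}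
    (fun X (𝒱' : PreZeroHypercover.{max w w₂} X) => ∃ 𝒱 : PreZeroHypercover.{w} X,
      𝒱' = (preZeroHypercoverULift.{w, v, u, w₂} 𝒱) ∧ Sieve.generate (Presieve.ofArrows 𝒱.X 𝒱.f) ∈ J X)
    ?_ ?_ _ ?_ X n
  · rintro X _ ⟨𝒱, rfl, h𝒱⟩
    refine J.superset_covering ?_ h𝒱
    rw [Sieve.generate_le_iff]
    rintro _ _ ⟨k⟩
    apply Sieve.le_generate
    exact Presieve.ofArrows.mk (ULift.up k)
  · intro X S₀ hS₀
    obtain ⟨𝒱, h𝒱, hS⟩ := hcof X S₀ hS₀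
    exact ⟨preZeroHypercoverULift 𝒱, ⟨𝒱, rfl, h𝒱⟩, fun k => hS k.down⟩
  · rintro X _ ⟨𝒱, rfl, -⟩ n
    exact cechCochainComplex_uliftFunctor_exactAt_succ 𝒱 I.obj n
      (cechCochainComplex_exactAt_succ_of_injective 𝒱.f J I n)

/-- The same at a terminal object `T`, for Mathlib's `Sheaf.H`: `Hᵖ(ulift I) = 0` for `p > 0`.
[folklore] -/
theorem subsingleton_sheafH_sheafCompose_uliftFunctor_of_injective
    (hcof : ∀ (X : C), ∀ S₀ ∈ J X, ∃ 𝒱 : PreZeroHypercover.{w} X,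
      Sieve.generate (Presieve.ofArrows 𝒱.X 𝒱.f) ∈ J X ∧ ∀ k, S₀ (𝒱.f k))
    (I : Sheaf J AddCommGrpCat.{max w v}) [Injective I] {T : C} (hT : IsTerminal T) (n : ℕ) :
    Subsingleton (Sheaf.H.{w'} ((sheafCompose J AddCommGrpCat.uliftFunctor.{w₂, max w v}).obj I)
      (n + 1)) := by
  haveI := subsingleton_ext_freeSheaf_sheafCompose_uliftFunctor_of_injective.{w', w, v, u, w₂}
    hcof I T n
  exact Ext.subsingleton_of_iso_left (freeSheafIsoConstantSheaf.{max w w₂} hT) (n + 1)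

end ULiftAcyclic

end Literature.Algebra.Homology
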